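import Mathlib
import Literature.AlgebraicGeometry.CossartPiltant200819.OrderAtClosedPoint2009
import HarnessLib

/-!
# Route `RadicialJung`, crux `CleanModels` (stmt-ResolutionOfSingularities-15917), line `Sketch` rev 35, stub 6 `stub_cleanProp44` (X44c):
# THE BIRTH COUNT ON A LINE — `Σ_{c'} (ν(c') − 1)·[κ(c'):κ] ≤ deg(D F)`, for EVERY residue field

Seat decomp-res-hand-2 g20 (structural hand).  Item (iii) of the hand-2 g19 census (`Cruxes/CleanModels/Lines/Sketch-memo-hand2-g19-stubs-5-7.md`
§2 (a)): the termination of birth chains is the `ν/δ*`-descent of memo `Sketch-memo-4e-cleanPermissible.md` §2.5–2.6.  Its COUNTING ENGINE is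
§2.6 (c): on a created line `Γ'' ≅ 𝔸¹_κ` carrying the restricted unit `F = U|_{Γ''} ∈ κ[w]`, a closed point `c' = (P)` (`P` prime, `d = deg P =
[κ(c'):κ]`) is a birth iff `2 ≤ ν(c') < ∞`, `ν(c') := sup_G ord_{c'}(F − G^p)`; «the `κ`-derivation `D` kills `p`-th powers and does not lower
orders by more than one at ANY closed point, so `ν(c') − 1 ≤ ord_{c'}(D F)` and `Σ_{c'} ord_{c'}(D F)·[κ(c'):κ] ≤ deg (D F)`».  The PER-POINT bound
is typed in the tree as the kernel form of [CP-II] II.5.3.2 (i) (✓ `Literature.….OrderAtClosedPoint.mul_natDegree_le_of_add_pow_mem`: `F·S^p + B^p ∈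
(P)^{e+1}`, `P ∤ S`, `D F ≠ 0` ⟹ `e·d ≤ deg(D F)`).  THIS FILE adds the SUM over distinct closed points — the bound on the weighted NUMBER of births of
one generation (memo 4e §2.5 «the number of births (with weights) is `≤ δ − 2`», §2.6 (c) «for every residue field») — and names the corner where the
coordinate derivation says nothing:

* `pow_dvd_derivation_of_add_pow_mem` — divisibility form of the per-point bound: `F·S^p + B^p ∈ (P)^{e+1}`, `P ∤ S` ⟹ `P^e ∣ D F` (any derivation
  `D`, over any base ring — `d/dw` over `κ`, or a derivation «w.r.t. constants» over `ℤ`).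
* `sum_mul_natDegree_le_of_add_pow_mem` — **THE COUNT**: for pairwise non-dividing primes `P_i` (distinct closed points `c'_i` of `𝔸¹_κ`, any residue
  degrees, separable or not) with `F·S_i^p + B_i^p ∈ (P_i)^{e_i+1}`, `P_i ∤ S_i`, and `D F ≠ 0`: `Σ_i e_i · deg P_i ≤ deg(D F)`.  With `e_i = ν(c'_i) − 1`
  this is `Σ (ν − 1)[κ(c'):κ] ≤ deg(D F)`; in particular at most `deg(D F)` births, each with `ν(c') ≤ 1 + deg(D F)/[κ(c'):κ]`.
* `card_mul_le_of_add_pow_mem_sq` — the unweighted corollary: the number of distinct closed points with `ν ≥ 2` (birth candidates), counted with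
  residue degree, is `≤ deg(D F)`.
* THE CORNER of §2.6 (d) for `D = d/dw`: `derivative_ne_zero_or_eq_expand` (`F' ≠ 0`, or `F ∈ κ[w^p]`); over a PERFECT field the second case means `F`
  IS a `p`-th power (`exists_eq_pow_of_derivative_eq_zero`), and then `ν = ∞` at every point (`sub_pow_mem_pow_of_eq_pow`: no birth anywhere — the line
  lies in a leaf); over an imperfect `κ` the case «`F ∈ κ[w^p]` not a `p`-th power» is exactly (B5′) «constant-type births», where only a derivation
  w.r.t. constants can feed the count (the lemmas allow any `D`).

Honest framing: OURS, elementary (a finite sum of the tree's per-point lemma); a TOOL for the termination author of (iii).  The link `δ*(c') ≤ ν(c')`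
(memo §2.6 (b), Hironaka's `δ` of the pair (`J`, leaf)) is NOT typed, so nothing here proves X44c, any case of `CleanModels`, or resolution of
singularities in characteristic `p`.  Setting only: [cite: CossartPiltant2009, ch.1 II.5.3.2 (i)] [cite: CossartPiltant2019, Lemma 6.3 (1)]
[cite: CossartPiltant2008, Prop. 4.4 (proof, p. 11)].
-/

noncomputable section

set_option linter.dupNamespace false -- mandated namespace of this single-conjunct summit

open Polynomial
open Literature.AlgebraicGeometry.CossartPiltant200819.OrderAtClosedPoint

namespace Summit.ResolutionOfSingularities.ResolutionOfSingularities.Theorems.RadicialJung.CleanModels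

variable {k : Type*} [Field k]

/-! ## §1 The per-point bound in divisibility form -/

/-- **`P^e ∣ D F`** at a closed point `(P)` of `𝔸¹_κ` where `F` is a `p`-th power to order `e + 1` (denominators `S ∉ (P)` allowed): the divisibility
behind ✓ `mul_natDegree_le_of_add_pow_mem`. [cite: CossartPiltant2009, ch.1 II.5.3.2 (i) proof, Case 2] -/
theorem pow_dvd_derivation_of_add_pow_mem (p : ℕ) [CharP k p] {R : Type*} [CommRing R] [Algebra R k[X]]
    (D : Derivation R k[X] k[X]) {P : k[X]} (hP : Prime P) {F S B : k[X]} (hS : ¬ P ∣ S) {e : ℕ}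
    (h : F * S ^ p + B ^ p ∈ Ideal.span {P} ^ (e + 1)) : P ^ e ∣ D F := by
  have h1 := derivation_apply_mem_pow_of_add_pow_mem p D _ e h
  have h2 : D (F * S ^ p) = S ^ p * D F := by
    rw [Derivation.leibniz, derivation_apply_pow_char, smul_zero, zero_add, smul_eq_mul]
  rw [h2, Ideal.span_singleton_pow, Ideal.mem_span_singleton] at h1
  exact hP.pow_dvd_of_dvd_mul_left e (fun h' => hS (hP.dvd_of_dvd_pow h')) h1

/-! ## §2 The count over distinct closed points -/

/-- **THE BIRTH COUNT ON A LINE** (memo 4e §2.6 (c), every residue field): `P_i` (`i ∈ s`) pairwise non-dividing primes of `κ[w]` — distinct closed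
points of `𝔸¹_κ` of residue degrees `deg P_i` —, `F·S_i^p + B_i^p ∈ (P_i)^{e_i+1}` with `P_i ∤ S_i` («`ν(c'_i) ≥ e_i + 1`», denominators allowed), and a
derivation `D` with `D F ≠ 0`.  Then `Σ_i e_i · deg P_i ≤ deg (D F)`. [cite: CossartPiltant2009, ch.1 II.5.3.2 (i)] [cite: CossartPiltant2008, Prop. 4.4 (proof, p. 11)] -/
theorem sum_mul_natDegree_le_of_add_pow_mem (p : ℕ) [CharP k p] {R : Type*} [CommRing R] [Algebra R k[X]]
    (D : Derivation R k[X] k[X]) {F : k[X]} (hDF : D F ≠ 0) {ι : Type*} (s : Finset ι) (P S B : ι → k[X]) (e : ι → ℕ)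
    (hP : ∀ i ∈ s, Prime (P i)) (hne : ∀ i ∈ s, ∀ j ∈ s, i ≠ j → ¬ P i ∣ P j) (hS : ∀ i ∈ s, ¬ P i ∣ S i)
    (h : ∀ i ∈ s, F * S i ^ p + B i ^ p ∈ Ideal.span {P i} ^ (e i + 1)) :
    ∑ i ∈ s, e i * (P i).natDegree ≤ (D F).natDegree := by
  classical
  -- each `P_i^{e_i}` divides `D F`, and they are pairwise coprime
  have hdvd : ∀ i ∈ s, P i ^ e i ∣ D F := fun i hi => pow_dvd_derivation_of_add_pow_mem p D (hP i hi) (hS i hi) (h i hi)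
  have hcop : (s : Set ι).Pairwise fun i j => IsCoprime (P i ^ e i) (P j ^ e j) := by
    intro i hi j hj hij
    exact (((hP i hi).irreducible.coprime_iff_not_dvd).mpr (hne i hi j hj hij)).pow
  have hprod : ∏ i ∈ s, P i ^ e i ∣ D F := Finset.prod_dvd_of_coprime hcop hdvd
  have hdeg : (∏ i ∈ s, P i ^ e i).natDegree = ∑ i ∈ s, e i * (P i).natDegree := by
    rw [Polynomial.natDegree_prod _ _ fun i hi => pow_ne_zero _ (hP i hi).ne_zero]
    exact Finset.sum_congr rfl fun i _ => by rw [Polynomial.natDegree_pow]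
  rw [← hdeg]
  exact Polynomial.natDegree_le_of_dvd hprod hDF

/-- **Corollary: at most `deg(D F)` birth candidates, counted with residue degree.**  If at each of the distinct closed points `(P_i)` the
polynomial `F` is a `p`-th power to second order (`F·S_i^p + B_i^p ∈ (P_i)²`, `P_i ∤ S_i` — «`ν ≥ 2`», the necessary condition for a birth), then
`Σ_i deg P_i ≤ deg(D F)`; in particular `#s ≤ deg(D F)`. [cite: CossartPiltant2008, Prop. 4.4 (proof, p. 11)] -/
theorem card_mul_le_of_add_pow_mem_sq (p : ℕ) [CharP k p] {R : Type*} [CommRing R] [Algebra R k[X]]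
    (D : Derivation R k[X] k[X]) {F : k[X]} (hDF : D F ≠ 0) {ι : Type*} (s : Finset ι) (P S B : ι → k[X])
    (hP : ∀ i ∈ s, Prime (P i)) (hne : ∀ i ∈ s, ∀ j ∈ s, i ≠ j → ¬ P i ∣ P j) (hS : ∀ i ∈ s, ¬ P i ∣ S i)
    (h : ∀ i ∈ s, F * S i ^ p + B i ^ p ∈ Ideal.span {P i} ^ 2) :
    ∑ i ∈ s, (P i).natDegree ≤ (D F).natDegree ∧ s.card ≤ (D F).natDegree := by
  have key := sum_mul_natDegree_le_of_add_pow_mem p D hDF s P S B (fun _ => 1) hP hne hS (fun i hi => by simpa using h i hi)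
  simp only [one_mul] at key
  refine ⟨key, le_trans ?_ key⟩
  rw [Finset.card_eq_sum_ones]
  exact Finset.sum_le_sum fun i hi => (hP i hi).irreducible.natDegree_pos

/-! ## §3 The corner of the coordinate derivation: `F' = 0` -/

/-- **Dichotomy for `D = d/dw`**: either `F' ≠ 0` (and §2 counts the births of `F`), or `F ∈ κ[w^p]` (`F = expand p G`). [folklore] -/
theorem derivative_ne_zero_or_eq_expand (p : ℕ) [hp : Fact p.Prime] [CharP k p] (F : k[X]) :
    derivative F ≠ 0 ∨ ∃ G : k[X], F = expand k p G := by
  by_cases hF : derivative F = 0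
  · exact Or.inr ⟨contract p F, (expand_contract p hF hp.out.ne_zero).symm⟩
  · exact Or.inl hF

/-- **Over a perfect field the corner is empty**: `F' = 0` forces `F` to be a `p`-th power (`F = expand p G = (Frob⁻¹ G)^p`). [folklore] -/
theorem exists_eq_pow_of_derivative_eq_zero (p : ℕ) [hp : Fact p.Prime] [CharP k p] [PerfectRing k p] {F : k[X]}
    (hF : derivative F = 0) : ∃ H : k[X], F = H ^ p := by
  obtain ⟨G, hG⟩ : ∃ G : k[X], F = expand k p G := ⟨contract p F, (expand_contract p hF hp.out.ne_zero).symm⟩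
  refine ⟨map ((frobeniusEquiv k p).symm : k →+* k) G, ?_⟩
  have h1 : map (frobenius k p) (map ((frobeniusEquiv k p).symm : k →+* k) G) = G := by
    rw [Polynomial.map_map]
    have h2 : (frobenius k p).comp ((frobeniusEquiv k p).symm : k →+* k) = RingHom.id k := by
      ext x
      simp
    rw [h2, Polynomial.map_id]
  rw [← map_frobenius_expand, Polynomial.map_expand, h1, ← hG]

/-- **A `p`-th power has `ν = ∞` at every point** (no birth anywhere: the line lies inside a leaf): `F = H^p` gives `F·1^p + (−H)^p ∈ I^n` for
every ideal `I` and every `n`. [folklore] -/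
theorem sub_pow_mem_pow_of_eq_pow (p : ℕ) [hp : Fact p.Prime] [CharP k p] {F H : k[X]} (hF : F = H ^ p) (I : Ideal k[X]) (n : ℕ) :
    F * 1 ^ p + (-H) ^ p ∈ I ^ n := by
  have h0 : F * 1 ^ p + (-H) ^ p = 0 := by
    rw [hF, one_pow, mul_one]
    rcases hp.out.eq_two_or_odd' with rfl | hodd
    · haveI : CharP k[X] 2 := inferInstance
      rw [neg_sq, CharTwo.add_self_eq_zero]
    · rw [hodd.neg_pow, add_neg_cancel]
  rw [h0]
  exact zero_mem _

/-- **Hence over a perfect field**: for `D = d/dw`, either `F' ≠ 0` and the births of `F` are counted by `sum_mul_natDegree_le_of_add_pow_mem`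
(total weight `≤ deg F' ≤ deg F − 1`), or `F` is a `p`-th power and has no birth at all.  (Over an imperfect field the missing case `F ∈ κ[w^p] ∖ κ[w]^p`
is (B5′) «constant-type births» of memo 4e §2.6 (d).) [cite: CossartPiltant2008, Prop. 4.4 (proof, p. 11)] -/
theorem derivative_ne_zero_or_exists_eq_pow (p : ℕ) [Fact p.Prime] [CharP k p] [PerfectRing k p] (F : k[X]) :
    (derivative F ≠ 0 ∧ (derivative F).natDegree + 1 ≤ F.natDegree) ∨ ∃ H : k[X], F = H ^ p := by
  by_cases hF : derivative F = 0
  · exact Or.inr (exists_eq_pow_of_derivative_eq_zero p hF)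
  · refine Or.inl ⟨hF, ?_⟩
    by_cases h0 : F.natDegree = 0
    · exact absurd (derivative_of_natDegree_zero h0) hF
    · have h1 := natDegree_derivative_lt (p := F) h0
      omega

end Summit.ResolutionOfSingularities.ResolutionOfSingularities.Theorems.RadicialJung.CleanModels

end
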